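import Mathlib.Analysis.Normed.Lp.lpSpace
import Mathlib.Analysis.InnerProductSpace.l2Space
import Mathlib.MeasureTheory.Function.L2Space
import Mathlib.Analysis.Fourier.AddCircleMulti
import Literature.Analysis.FunctionSpaces.Complexify
import Literature.Analysis.FunctionSpaces.FlatTorus
import Literature.Analysis.FunctionSpaces.TorusCalculus
import Literature.Analysis.FunctionSpaces.TorusTestFunction
import Literature.Analysis.FunctionSpaces.TorusSobolevNorm
import HarnessLib

-- provenance: harness21/H21/H21/Prelude/Sobolev/TorusSobolevSpace.lean @ 1a97641 (interim HEAD d8f2665); M5 mechanical rewrite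
/-!
# Bundled Sobolev spaces `H^s(T^d; F)` and the energy spaces `H`, `V` (Sobolev trunk, C5)

This file is `sobolev_Hs_torus` part 2 of the outline `H21/Outlines/Sobolev.md`, §C5. It bundles
the spectral Sobolev scale of `Literature.Prelude.Sobolev.TorusSobolevNorm` (part 1) into a Hilbert space

  `TorusSobolev s d F ≃ { (⟨k⟩^s f̂(k))_k ∈ ℓ²(ℤ^d; F) }`,

realised on the Fourier side as the weighted sequence space: an element `u : TorusSobolev s d F`
*stores* the sequence `k ↦ ⟨k⟩^s f̂(k)`, and `u.coeff k = ⟨k⟩^{-s} u k` is the Fourier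
coefficient it represents. All the Hilbert-space structure is inherited from Mathlib's `lp` by
`inferInstanceAs`. The bridge to functions is `TorusSobolev.ofFun` / `TorusSobolev.Represents`.

The second part defines the energy spaces of incompressible hydrodynamics on `T^d` for *real*
vector fields (Constantin–Foias, Ch. 4; Temam, Ch. I §1.4):

* `Torus.smoothSolenoidal d` — the set `𝒱` of (`L²` classes of) smooth, divergence-free,
  mean-zero vector fields;
* `Torus.energySpace d = H` — the `L²` closure of `span 𝒱`, a closed submodule of
  `Lp (EuclideanSpace ℝ d) 2 volume`;
* `Torus.energySpaceV d = V = H ∩ H¹`.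

## Mathlib

* `lp (fun _ : d → ℤ ↦ F) 2` with `lp.normedAddCommGroup`, `lp.instNormedSpace`,
  `lp.instInnerProductSpace`, `lp.completeSpace` (`Mathlib/Analysis/Normed/Lp/lpSpace.lean`,
  `Mathlib/Analysis/InnerProductSpace/l2Space.lean`); `Memℓp`, `lp.ext`.
* `MeasureTheory.Lp`, `Submodule.span`, `Submodule.topologicalClosure`,
  `Submodule.isClosed_topologicalClosure`.
* Mathlib has no Sobolev space on the torus and no solenoidal `L²` space; its `ℝⁿ` scale is
  `TemperedDistribution.MemSobolev` (`Mathlib/Analysis/Distribution/Sobolev.lean`).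

## Design

* **`s` is a phantom parameter of `TorusSobolev s d F`.** The carrier is literally
  `ℓ²(ℤ^d; F)` for every `s`; only the interpretation of the stored sequence (as `⟨k⟩^s f̂(k)`)
  depends on `s`, and `TorusSobolev.coeff` is the *only* `s`-dependent piece of API. In
  particular there is no coercion `TorusSobolev s d F → TorusSobolev s' d F` by "identity": the
  inclusion `H^s ↪ H^{s'}` (`s' ≤ s`) is the reweighting `u ↦ (⟨k⟩^{s'-s} u k)_k`, not provided
  in v0.
* Complex targets `F` (`mFourierCoeff` needs `[NormedSpace ℂ F]`); real fields enter through
  `EuclideanSpace.complexify` exactly as in part 1.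
* `H` is defined as a topological closure, so it is a closed submodule with no proof obligation;
  its identification with `{v ∈ L² | div v = 0 weakly, ∫ v = 0}` is the (sorried) lemma
  `Torus.mem_energySpace_iff` (Constantin–Foias, Prop. 4.3 / Temam, Ch. I Thm. 1.4 on `T^d`).

## References

* P. Constantin, C. Foias, *Navier–Stokes Equations* (1988), Ch. 4 (spaces `H`, `V`).
* R. Temam, *Navier–Stokes Equations and Nonlinear Functional Analysis*, 2nd ed. (1995), Ch. I
  §1–2 (`H^s_per`, `H`, `V` in the periodic case).
* H. Bahouri, J.-Y. Chemin, R. Danchin, *Fourier Analysis and Nonlinear PDEs* (2011), §1.3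
  (`H^s` as a Hilbert space on the Fourier side).
* L. Grafakos, *Classical Fourier Analysis*, 3rd ed. (2014), §3.1–3.3.
-/

open MeasureTheory Set Filter Topology UnitAddTorus
open scoped ENNReal NNReal

noncomputable section

namespace Literature.Analysis.FunctionSpaces

/-! ## The bundled space `H^s(T^d; F)` -/

/-- The Sobolev space `H^s(T^d; F)` as a Hilbert space, realised on the Fourier side: an element
stores the square-summable weighted sequence `k ↦ ⟨k⟩^s f̂(k)` in `ℓ²(ℤ^d; F)`, so that
`‖u‖ = (∑_k ⟨k⟩^{2s} ‖f̂(k)‖²)^{1/2} = ‖f‖_{H^s}` (Bahouri–Chemin–Danchin, §1.3.1; Temam, Ch. I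
§2, `H^s_per`; Grafakos, §3.3). **`s` is a phantom parameter:** the carrier is the same type
`lp (fun _ : d → ℤ ↦ F) 2` for every `s`; only `TorusSobolev.coeff` (the represented Fourier
coefficient `⟨k⟩^{-s} u k`) depends on `s`. [folklore] -/
@[nolint unusedArguments]
def TorusSobolev (_s : ℝ) (d : Type*) [Fintype d] (F : Type*) [NormedAddCommGroup F] : Type _ :=
  lp (fun _ : d → ℤ => F) 2

namespace TorusSobolev

variable {s : ℝ} {d : Type*} [Fintype d]
variable {F : Type*} [NormedAddCommGroup F]

/-- `H^s(T^d; F)` is a normed additive group (the `ℓ²` norm of the stored weighted sequence;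
Bahouri–Chemin–Danchin, §1.3.1). Inherited from `lp`. [folklore] -/
instance instNormedAddCommGroup : NormedAddCommGroup (TorusSobolev s d F) :=
  inferInstanceAs (NormedAddCommGroup (lp (fun _ : d → ℤ => F) 2))

/-- `H^s(T^d; F)` is a complex normed space (Bahouri–Chemin–Danchin, §1.3.1). Inherited from
`lp`. [folklore] -/
instance instNormedSpace [NormedSpace ℂ F] : NormedSpace ℂ (TorusSobolev s d F) :=
  inferInstanceAs (NormedSpace ℂ (lp (fun _ : d → ℤ => F) 2))

/-- `H^s(T^d; F)` is a complex inner product space, `⟪u, v⟫ = ∑_k ⟨k⟩^{2s} ⟪û(k), v̂(k)⟫`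
(Bahouri–Chemin–Danchin, §1.3.1; Temam, Ch. I §2). Inherited from `lp.instInnerProductSpace`
(which, unlike the outline anticipated, needs no `[CompleteSpace F]`). [folklore] -/
instance instInnerProductSpace [InnerProductSpace ℂ F] :
    InnerProductSpace ℂ (TorusSobolev s d F) :=
  inferInstanceAs (InnerProductSpace ℂ (lp (fun _ : d → ℤ => F) 2))

/-- `H^s(T^d; F)` is complete, hence a Hilbert space for Hilbert `F` (Bahouri–Chemin–Danchin,
Prop. 1.3.2 adapted; Temam, Ch. I §2). Inherited from `lp`. [folklore] -/
instance instCompleteSpace [CompleteSpace F] : CompleteSpace (TorusSobolev s d F) :=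
  inferInstanceAs (CompleteSpace (lp (fun _ : d → ℤ => F) 2))

/-- The stored weighted sequence `k ↦ ⟨k⟩^s f̂(k)` of an element of `H^s(T^d; F)` (coercion to
`lp`, then to functions). [folklore] -/
instance instCoeFun : CoeFun (TorusSobolev s d F) fun _ => (d → ℤ) → F :=
  ⟨fun u => Subtype.val u⟩

/-- Extensionality: two elements of `H^s(T^d; F)` with the same stored sequence are equal
(`lp.ext`). [folklore] -/
@[ext]
theorem ext {u v : TorusSobolev s d F} (h : (u : (d → ℤ) → F) = v) : u = v :=
  lp.ext h

/-- The stored sequence of `u ∈ H^s` is square summable. [folklore] -/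
theorem memℓp (u : TorusSobolev s d F) : Memℓp (u : (d → ℤ) → F) 2 :=
  lp.memℓp (show lp (fun _ : d → ℤ => F) 2 from u)

variable [NormedSpace ℂ F]

/-- The `k`-th Fourier coefficient represented by `u ∈ H^s(T^d; F)`: `û(k) = ⟨k⟩^{-s} u k`, where
`u k` is the stored weighted coefficient. This is the only `s`-dependent piece of API of the
phantom-indexed type `TorusSobolev s d F` (Bahouri–Chemin–Danchin, §1.3.1). [folklore] -/
def coeff (u : TorusSobolev s d F) (k : d → ℤ) : F :=
  (Torus.sobolevWeight (-s) k : ℂ) • (u : (d → ℤ) → F) k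

/-- `u ∈ H^s(T^d; F)` represents the function `f : T^d → F`: `f` is integrable and its Fourier
coefficients are those of `u`, `f̂(k) = u.coeff k` for all `k` (Grafakos, §3.3; for `s ≥ 0` every
`u` represents a unique `L²` class, for `s < 0` only those `u` coming from `L¹` functions do). [folklore] -/
def Represents (u : TorusSobolev s d F) (f : UnitAddTorus d → F) : Prop :=
  Integrable f volume ∧ ∀ k, mFourierCoeff f k = u.coeff k

/-- The element of `H^s(T^d; F)` defined by a function `f` whose weighted Fourier sequence
`k ↦ ⟨k⟩^s f̂(k)` is square summable (Bahouri–Chemin–Danchin, §1.3.1). Use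
`Torus.MemSobolev.memℓp` to produce the hypothesis from `MemSobolev s f`. [folklore] -/
def ofFun (f : UnitAddTorus d → F)
    (hf : Memℓp (fun k : d → ℤ => (Torus.sobolevWeight s k : ℂ) • mFourierCoeff f k) 2) :
    TorusSobolev s d F :=
  ⟨_, hf⟩

/-- The stored sequence of `ofFun f hf` is `k ↦ ⟨k⟩^s f̂(k)`. [folklore] -/
@[simp]
theorem coeFn_ofFun (f : UnitAddTorus d → F)
    (hf : Memℓp (fun k : d → ℤ => (Torus.sobolevWeight s k : ℂ) • mFourierCoeff f k) 2) :
    (ofFun f hf : (d → ℤ) → F) = fun k => (Torus.sobolevWeight s k : ℂ) • mFourierCoeff f k :=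
  rfl

/-- `ofFun f hf` represents the Fourier coefficients of `f`: `(ofFun f hf).coeff k = f̂(k)`
(`⟨k⟩^{-s} ⟨k⟩^{s} = 1`). [folklore] -/
@[simp]
theorem coeff_ofFun (f : UnitAddTorus d → F)
    (hf : Memℓp (fun k : d → ℤ => (Torus.sobolevWeight s k : ℂ) • mFourierCoeff f k) 2)
    (k : d → ℤ) : (ofFun f hf).coeff k = mFourierCoeff f k := by
  simp only [coeff, coeFn_ofFun, smul_smul, ← Complex.ofReal_mul,
    Torus.sobolevWeight_neg_mul_sobolevWeight, Complex.ofReal_one, one_smul]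

/-- An integrable `f` with square-summable weighted Fourier sequence is represented by
`ofFun f hf`. [folklore] -/
theorem represents_ofFun {f : UnitAddTorus d → F} (hfi : Integrable f volume)
    (hf : Memℓp (fun k : d → ℤ => (Torus.sobolevWeight s k : ℂ) • mFourierCoeff f k) 2) :
    (ofFun f hf).Represents f :=
  ⟨hfi, fun k => (coeff_ofFun f hf k).symm⟩

/-- The (extended) norm of `ofFun f hf` is the `H^s` norm of `f`: `‖ofFun f hf‖ₑ = ‖f‖_{H^s}`
(both are `(∑_k ⟨k⟩^{2s} ‖f̂(k)‖²)^{1/2}`; Bahouri–Chemin–Danchin, §1.3.1). [folklore] -/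
theorem enorm_ofFun (f : UnitAddTorus d → F)
    (hf : Memℓp (fun k : d → ℤ => (Torus.sobolevWeight s k : ℂ) • mFourierCoeff f k) 2) :
    ‖ofFun f hf‖ₑ = Torus.eSobolevNorm s f := by
  have h2 : (0 : ℝ) < (2 : ℝ≥0∞).toReal := by norm_num
  have hterm : ∀ k : d → ℤ,
      ‖(Torus.sobolevWeight s k : ℂ) • mFourierCoeff f k‖ ^ (2 : ℝ≥0∞).toReal =
        Torus.sobolevWeight s k ^ 2 * ‖mFourierCoeff f k‖ ^ 2 := fun k => by
    rw [ENNReal.toReal_ofNat, Real.rpow_two, norm_smul, mul_pow, Complex.norm_real,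
      Real.norm_of_nonneg (Torus.sobolevWeight_pos s k).le]
  have hsum :
      Summable fun k : d → ℤ => Torus.sobolevWeight s k ^ 2 * ‖mFourierCoeff f k‖ ^ 2 := by
    simpa only [hterm] using (memℓp_gen_iff h2).1 hf
  rw [← ofReal_norm, Torus.eSobolevNorm]
  change ENNReal.ofReal ‖(⟨_, hf⟩ : lp (fun _ : d → ℤ => F) 2)‖ = _
  rw [lp.norm_eq_tsum_rpow h2]
  change ENNReal.ofReal ((∑' i : d → ℤ, ‖(Torus.sobolevWeight s i : ℂ) • mFourierCoeff f i‖ ^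
    (2 : ℝ≥0∞).toReal) ^ (1 / (2 : ℝ≥0∞).toReal)) = _
  simp_rw [hterm]
  rw [← ENNReal.ofReal_rpow_of_nonneg (tsum_nonneg fun _ => by positivity) (by positivity),
    ENNReal.ofReal_tsum_of_nonneg (fun _ => by positivity) hsum, ENNReal.toReal_ofNat]
  congr 1
  refine tsum_congr fun k => ?_
  rw [ENNReal.ofReal_mul (sq_nonneg _), ← ofReal_norm, ← ENNReal.ofReal_pow (norm_nonneg _)]

/-- Real-valued form of `TorusSobolev.enorm_ofFun`: `‖ofFun f hf‖ = ‖f‖_{H^s}`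
(`Torus.sobolevNorm`; Bahouri–Chemin–Danchin, §1.3.1). [folklore] -/
theorem norm_ofFun (f : UnitAddTorus d → F)
    (hf : Memℓp (fun k : d → ℤ => (Torus.sobolevWeight s k : ℂ) • mFourierCoeff f k) 2) :
    ‖ofFun f hf‖ = Torus.sobolevNorm s f := by
  rw [Torus.sobolevNorm, ← enorm_ofFun f hf, toReal_enorm]

end TorusSobolev

namespace Torus

variable {d : Type*} [Fintype d]
variable {F : Type*} [NormedAddCommGroup F] [NormedSpace ℂ F]

/-- Bridge from the predicate to the bundled space: if `f ∈ H^s(T^d; F)` (`MemSobolev s f`), then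
its weighted Fourier sequence `k ↦ ⟨k⟩^s f̂(k)` is in `ℓ²`, so `TorusSobolev.ofFun f` applies
(unfolding `eSobolevNorm s f < ∞`; Grafakos, §3.3). [folklore] -/
theorem MemSobolev.memℓp {s : ℝ} {f : UnitAddTorus d → F} (hf : MemSobolev s f) :
    Memℓp (fun k : d → ℤ => (sobolevWeight s k : ℂ) • mFourierCoeff f k) 2 := by
  have h2 : (0 : ℝ) < (2 : ℝ≥0∞).toReal := by norm_num
  rw [memℓp_gen_iff h2]
  have hlt := hf.2
  rw [eSobolevNorm, ENNReal.rpow_lt_top_iff_of_pos (by norm_num : (0 : ℝ) < 1 / 2)] at hlt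
  refine (ENNReal.summable_toReal hlt.ne).congr fun k => ?_
  rw [ENNReal.toReal_ofReal_mul _ _ (sq_nonneg _), ENNReal.toReal_pow, toReal_enorm,
    ENNReal.toReal_ofNat, Real.rpow_two, norm_smul, mul_pow, Complex.norm_real,
    Real.norm_of_nonneg (sobolevWeight_pos s k).le]

/-- The bundled element `⟨f⟩ ∈ H^s(T^d; F)` of an `H^s` function `f`. [folklore] -/
def MemSobolev.toTorusSobolev {s : ℝ} {f : UnitAddTorus d → F} (hf : MemSobolev s f) :
    TorusSobolev s d F :=
  TorusSobolev.ofFun f hf.memℓp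

/-- `hf.toTorusSobolev` represents `f`. [folklore] -/
theorem MemSobolev.represents_toTorusSobolev {s : ℝ} {f : UnitAddTorus d → F}
    (hf : MemSobolev s f) : hf.toTorusSobolev.Represents f :=
  TorusSobolev.represents_ofFun hf.integrable hf.memℓp

/-! ## Energy spaces `H` and `V` of real vector fields on `T^d` -/

section Energy

variable [DecidableEq d]

variable (d) in
/-- The set `𝒱` of (`L²` classes of) smooth solenoidal mean-zero vector fields on `T^d`:
`v ∈ L²(T^d; ℝ^d)` having a representative `f` with `f ∈ C^∞`, `div f = 0`, `∫ f = 0`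
(Constantin–Foias, Ch. 4, the space `𝒱`; Temam, Ch. I §1.4, eq. (1.31) periodic case). [folklore] -/
def smoothSolenoidal :
    Set (Lp (EuclideanSpace ℝ d) 2 (volume : Measure (UnitAddTorus d))) :=
  {v | ∃ f : UnitAddTorus d → EuclideanSpace ℝ d,
    IsSmooth f ∧ IsDivFree f ∧ HasZeroMean f ∧
      (v : UnitAddTorus d → EuclideanSpace ℝ d) =ᵐ[volume] f}

variable (d) in
/-- The energy space `H = L²_σ(T^d)` of incompressible hydrodynamics: the `L²` closure of the
span of the smooth solenoidal mean-zero fields `𝒱`, a closed subspace of `L²(T^d; ℝ^d)`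
(Constantin–Foias, Ch. 4, Def. of `H`; Temam, Ch. I §1.4). Its intrinsic description
`H = {v ∈ L² | div v = 0 weakly, ∫ v = 0}` is `Torus.mem_energySpace_iff`. [folklore] -/
def energySpace : Submodule ℝ (Lp (EuclideanSpace ℝ d) 2 (volume : Measure (UnitAddTorus d))) :=
  (Submodule.span ℝ (smoothSolenoidal d)).topologicalClosure

variable (d) in
/-- The energy space `V = H ∩ H¹(T^d; ℝ^d)`: solenoidal mean-zero `L²` fields with one (spectral)
derivative in `L²`, the real field being complexified componentwise for `Torus.MemSobolev`
(Constantin–Foias, Ch. 4, Def. of `V`; Temam, Ch. I §1.4). [folklore] -/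
def energySpaceV : Set (Lp (EuclideanSpace ℝ d) 2 (volume : Measure (UnitAddTorus d))) :=
  {v | v ∈ energySpace d ∧
    MemSobolev 1 (EuclideanSpace.complexify ∘ (v : UnitAddTorus d → EuclideanSpace ℝ d))}

/-- `𝒱 ⊆ H`. [folklore] -/
theorem smoothSolenoidal_subset_energySpace :
    smoothSolenoidal d ⊆ (↑(energySpace d) : Set (Lp (EuclideanSpace ℝ d) 2 volume)) :=
  Submodule.subset_span.trans (Submodule.le_topologicalClosure _)

/-- `V ⊆ H`. [folklore] -/
theorem energySpaceV_subset_energySpace :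
    energySpaceV d ⊆ (↑(energySpace d) : Set (Lp (EuclideanSpace ℝ d) 2 volume)) :=
  fun _ hv => hv.1

/-- `H` is closed in `L²(T^d; ℝ^d)` (by construction, `Submodule.isClosed_topologicalClosure`;
Constantin–Foias, Ch. 4). [folklore] -/
theorem isClosed_energySpace :
    IsClosed
      (energySpace d : Set (Lp (EuclideanSpace ℝ d) 2 (volume : Measure (UnitAddTorus d)))) :=
  Submodule.isClosed_topologicalClosure _

/-- Intrinsic description of `H`: an `L²` vector field lies in `H` iff it is weakly divergence
free (`∫ ⟪v, ∇θ⟫ = 0` for all smooth `θ`) and has zero mean (Constantin–Foias, Ch. 1 Prop. 1.8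
(1.6) with the Helmholtz decomposition Prop. 1.9, bounded domains; Temam, Ch. I Thm. 1.4 and Rem. 1.6, periodic case: on `T^d` there
is no boundary, and the mean-zero condition replaces the normal-trace condition). On `T^d` this is
the equality of the closure of `𝒱` with Constantin–Foias' Fourier-side definition (4.33) of `H`.
PROVED: `mem_energySpace_iff_holds` (`Literature/Analysis/FluidPDE/EnergySpaceTorusProofs.lean`).
[cite: ConstantinFoiasNSE1988, Ch. 4 (4.33) (periodic H: u₀ = 0, ⟨u_k, k⟩ = 0); Ch. 1 Prop. 1.8 (1.6)] -/
def mem_energySpace_iff : Prop :=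
  ∀ (v : Lp (EuclideanSpace ℝ d) 2 (volume : Measure (UnitAddTorus d))),
    v ∈ energySpace d ↔
      IsWeaklyDivFree (v : UnitAddTorus d → EuclideanSpace ℝ d) ∧
        HasZeroMean (v : UnitAddTorus d → EuclideanSpace ℝ d)

/-- `𝒱 ⊆ V`: smooth solenoidal mean-zero fields have finite `H¹` norm (Constantin–Foias' periodic
`V`, (4.34): the `H_{1,L}` sequences with `u₀ = 0`, `⟨u_k, k⟩ = 0`). [cite: ConstantinFoiasNSE1988, Ch. 4 (4.34)] -/
def smoothSolenoidal_subset_energySpaceV : Prop :=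
  smoothSolenoidal d ⊆ energySpaceV d

end Energy

end Torus

end Literature.Analysis.FunctionSpaces
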